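import Summits.AtomisticToContinuum.FouriersLaw.Theorems.EmbeddedDrudeMourreMourreDissolutionFibreLorentzian
import Summits.AtomisticToContinuum.FouriersLaw.Theorems.EmbeddedDrudeMourreFGRGapBranchA
import Summits.AtomisticToContinuum.FouriersLaw.Theorems.EmbeddedDrudeMourreFGRGapGenericA
import Summits.AtomisticToContinuum.FouriersLaw.Theorems.EmbeddedDrudeMourreFGRGapClosingD
import Literature.MathematicalPhysics.KineticTheory.PinnedChainResonantFinite
import HarnessLib

/-!
# The fibre dictionary: Lorentzian-regularised energy delta → ALS's resolved collision kernel

Helper file for crux `EmbeddedDrudeMourre.MourreDissolution` (item stmt-AtomisticToContinuum-12594,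
line `swap-odd-threshold-rigidity`, stub B `stub_freeLevelShift`), registered helper stubs
`tendsto_fibre_lorentzian_resonantSet` and `ae_goodFibre`.

On a GOOD partner-momentum fibre `(k₁, k₃)` of the cell (`k₁ ≠ k₃`, `π` not resonant, all zeros of
`Ω(k₁, ·, k₃)` simple) the `k₂`-integral of `W(k₂) ν/(Ω(k₂)² + ν²)`,
`W = Φ²/(ω₁ω₂ω₃ω₄)² [f]²`, tends as `ν ↓ 0` to `π Σ_z W(z)/|∂₂Ω(z)|` (the fibre lemma
`FibreLorentzian.tendsto_setIntegral_lorentzian_of_simple_zeros'`), and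
`W(z)/|∂₂Ω(z)| = collisionWeight(z) [f]²(z) / alsPrefactor` since `∂₂Ω = v(k₂) - v(k₄)`:
the limit is `(π / alsPrefactor) Σᶠ_{k₂ ∈ resonantSet} collisionWeight · [f]²`, ALS's resolved
energy delta [AokiLukkarinenSpohn2006, eqs. (4.10)-(4.11)].

`ae_goodFibre` (second registered helper stub): almost every fibre of the cell `(-π,π]²` is good.
The bad set lies in the union of two Lebesgue-null plane sets: the set `Ω(k₁, π, k₃) = 0` (each
`k₁`-section is the zero set of a real-analytic function of `k₃` which is not identically zero,
`Generic.resonanceFn_const_partner`, hence countable) and the equal-velocity curve `v(k₃) = v(k₁)`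
(`Generic.volume_equalVelocity`), which contains the diagonal `k₁ = k₃` and every off-diagonal cell
fibre carrying a degenerate zero (`Branch.modEq_of_velocity_eq`: a degenerate zero is congruent to
the exchange zero `k₃`, so `v(k₃) = v(k₂) = v(k₁ + k₂ - k₃) = v(k₁)`).
-/

noncomputable section

namespace Summit.AtomisticToContinuum.FouriersLaw.Theorems.MourreDissolution

open MeasureTheory Filter Set Function Topology Real
open scoped ENNReal
open Literature.MathematicalPhysics.KineticTheory.PhononBoltzmann
open Summit.AtomisticToContinuum.FouriersLaw.Theorems.FGRGap.FoldJetRigidity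
open Summit.AtomisticToContinuum.FouriersLaw.Theorems.FGRGap.FoldJetRigidity.Branch

/-! ## The fibre dictionary -/

/-- On a good fibre every zero of `Ω(k₁, ·, k₃)` on the closed cell `[-π, π]` lies in the (finite)
resonant set: `-π` is not a zero because `π` is not (`2π`-periodicity in `k₂`). [folklore] -/
theorem fibreDict_mem_resonantSet_of_zero {ω₂ k₁ k₃ : ℝ} (hπ : resonanceFn ω₂ k₁ π k₃ ≠ 0)
    {x : ℝ} (hx : x ∈ Icc (-π) π) (hx0 : resonanceFn ω₂ k₁ x k₃ = 0) :
    x ∈ resonantSet ω₂ k₁ k₃ := by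
  refine ⟨⟨lt_of_le_of_ne hx.1 (fun h => hπ ?_), hx.2⟩, hx0⟩
  subst h
  have hp := resonanceFn_add_two_pi₂ ω₂ k₁ (-π) k₃
  rw [show -π + 2 * π = π by ring] at hp
  rw [hp]
  exact hx0

/-- On a good fibre the resonant momenta are interior points of the cell: `z < π` because `π` is
not resonant. [folklore] -/
theorem fibreDict_mem_Ioo_of_mem_resonantSet {ω₂ k₁ k₃ : ℝ} (hπ : resonanceFn ω₂ k₁ π k₃ ≠ 0)
    {z : ℝ} (hz : z ∈ resonantSet ω₂ k₁ k₃) : z ∈ Ioo (-π) π := by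
  refine ⟨hz.1.1, lt_of_le_of_ne hz.1.2 (fun h => hπ ?_)⟩
  rw [← h]
  exact hz.2

/-- The termwise dictionary: `collisionWeight · [f]² = alsPrefactor · (W / |∂₂Ω|)` with
`W = Φ²/(ω₁ω₂ω₃ω₄)² [f]²` (also at the junk value `∂₂Ω = 0`, both sides being `0`).
[cite: AokiLukkarinenSpohn2006, eqs. (4.10)-(4.11)] -/
theorem fibreDict_collisionWeight_mul (ω₂ a b k₁ k₂ k₃ B : ℝ) :
    collisionWeight ω₂ a b k₁ k₂ k₃ * B =
      alsPrefactor * (vertex a b k₁ k₂ k₃ ^ 2 /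
        (dispersion ω₂ k₁ * dispersion ω₂ k₂ * dispersion ω₂ k₃ * dispersion ω₂ (k₁ + k₂ - k₃)) ^ 2 *
          B / |groupVelocity ω₂ k₂ - groupVelocity ω₂ (k₁ + k₂ - k₃)|) := by
  unfold collisionWeight resonanceJacobian
  ring

/-- **The fibre dictionary** (binder form). On a good fibre `(k₁, k₃)` of the cell — `k₁ ≠ k₃`,
`π` not resonant, every zero of `Ω(k₁, ·, k₃)` simple — the Lorentzian-regularised energy delta
weighted by `W = Φ²/(ω₁ω₂ω₃ω₄)² [f]²` converges, as `ν ↓ 0`, to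
`(π / alsPrefactor) Σᶠ_{k₂ ∈ resonantSet} collisionWeight · [f]²`, ALS's resolved energy delta.
[cite: AokiLukkarinenSpohn2006, eqs. (4.10)-(4.11)] -/
theorem tendsto_fibre_lorentzian_resonantSet' {ω₂ a b : ℝ} (hω : 0 < ω₂) {f : ℝ → ℝ}
    (hf : Continuous f) {k₁ k₃ : ℝ} (hk₁ : k₁ ∈ Ioc (-π) π) (hk₃ : k₃ ∈ Ioc (-π) π)
    (hne : k₁ ≠ k₃) (hπ : resonanceFn ω₂ k₁ π k₃ ≠ 0)
    (hsimple : ∀ k₂ : ℝ, resonanceFn ω₂ k₁ k₂ k₃ = 0 →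
      groupVelocity ω₂ k₂ ≠ groupVelocity ω₂ (k₁ + k₂ - k₃)) :
    Tendsto (fun ν : ℝ => ∫ k₂ in Ioc (-π) π,
      vertex a b k₁ k₂ k₃ ^ 2 /
        (dispersion ω₂ k₁ * dispersion ω₂ k₂ * dispersion ω₂ k₃ * dispersion ω₂ (k₁ + k₂ - k₃)) ^ 2 *
        (f k₁ + f k₂ - f k₃ - f (k₁ + k₂ - k₃)) ^ 2 * (ν / (resonanceFn ω₂ k₁ k₂ k₃ ^ 2 + ν ^ 2)))
      (𝓝[>] 0)
      (𝓝 (π / alsPrefactor * ∑ᶠ k₂ ∈ resonantSet ω₂ k₁ k₃,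
        collisionWeight ω₂ a b k₁ k₂ k₃ * (f k₁ + f k₂ - f k₃ - f (k₁ + k₂ - k₃)) ^ 2)) := by
  have hfin : (resonantSet ω₂ k₁ k₃).Finite := resonantSet_finite hω hk₁ hk₃ hne
  -- the fibre lemma's data
  have hgc : ContinuousOn (fun k₂ => resonanceFn ω₂ k₁ k₂ k₃) (Icc (-π) π) :=
    (continuous_resonanceFn₂ hω k₁ k₃).continuousOn
  have hD : Continuous fun k₂ =>
      dispersion ω₂ k₁ * dispersion ω₂ k₂ * dispersion ω₂ k₃ * dispersion ω₂ (k₁ + k₂ - k₃) := by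
    unfold dispersion; fun_prop
  have hV : Continuous fun k₂ => vertex a b k₁ k₂ k₃ := by unfold vertex; fun_prop
  have hB : Continuous fun k₂ => f k₁ + f k₂ - f k₃ - f (k₁ + k₂ - k₃) := by fun_prop
  have hφ : Continuous fun k₂ => vertex a b k₁ k₂ k₃ ^ 2 /
      (dispersion ω₂ k₁ * dispersion ω₂ k₂ * dispersion ω₂ k₃ * dispersion ω₂ (k₁ + k₂ - k₃)) ^ 2 *
      (f k₁ + f k₂ - f k₃ - f (k₁ + k₂ - k₃)) ^ 2 := by
    refine ((hV.pow 2).div (hD.pow 2) fun k₂ => ?_).mul (hB.pow 2)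
    have h1 := dispersion_pos hω k₁
    have h2 := dispersion_pos hω k₂
    have h3 := dispersion_pos hω k₃
    have h4 := dispersion_pos hω (k₁ + k₂ - k₃)
    exact pow_ne_zero _ (mul_pos (mul_pos (mul_pos h1 h2) h3) h4).ne'
  have hZ : ∀ z ∈ hfin.toFinset, z ∈ Ioo (-π) π ∧ resonanceFn ω₂ k₁ z k₃ = 0 ∧
      HasDerivAt (fun k₂ => resonanceFn ω₂ k₁ k₂ k₃)
        (groupVelocity ω₂ z - groupVelocity ω₂ (k₁ + z - k₃)) z ∧
      groupVelocity ω₂ z - groupVelocity ω₂ (k₁ + z - k₃) ≠ 0 := by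
    intro z hz
    rw [Set.Finite.mem_toFinset] at hz
    exact ⟨fibreDict_mem_Ioo_of_mem_resonantSet hπ hz, hz.2, hasDerivAt_resonanceFn hω k₁ z k₃,
      sub_ne_zero.2 (hsimple z hz.2)⟩
  have hnz : ∀ x ∈ Icc (-π) π, resonanceFn ω₂ k₁ x k₃ = 0 → x ∈ hfin.toFinset := fun x hx hx0 =>
    (Set.Finite.mem_toFinset hfin).2 (fibreDict_mem_resonantSet_of_zero hπ hx hx0)
  have key := FibreLorentzian.tendsto_setIntegral_lorentzian_of_simple_zeros'
    (g' := fun z => groupVelocity ω₂ z - groupVelocity ω₂ (k₁ + z - k₃))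
    (by linarith [Real.pi_pos]) hgc hφ.continuousOn hfin.toFinset hZ hnz
  -- identification of the limit
  have hlim : π / alsPrefactor * ∑ᶠ k₂ ∈ resonantSet ω₂ k₁ k₃,
      collisionWeight ω₂ a b k₁ k₂ k₃ * (f k₁ + f k₂ - f k₃ - f (k₁ + k₂ - k₃)) ^ 2 =
      π * ∑ z ∈ hfin.toFinset, vertex a b k₁ z k₃ ^ 2 /
        (dispersion ω₂ k₁ * dispersion ω₂ z * dispersion ω₂ k₃ * dispersion ω₂ (k₁ + z - k₃)) ^ 2 *
        (f k₁ + f z - f k₃ - f (k₁ + z - k₃)) ^ 2 /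
        |groupVelocity ω₂ z - groupVelocity ω₂ (k₁ + z - k₃)| := by
    rw [finsum_mem_eq_finite_toFinset_sum _ hfin,
      Finset.sum_congr rfl fun z _ => fibreDict_collisionWeight_mul ω₂ a b k₁ z k₃ _,
      ← Finset.mul_sum, ← mul_assoc, div_mul_cancel₀ _ alsPrefactor_pos.ne']
  rw [hlim]
  exact key

/-- **The fibre dictionary** (registered helper stub of stub B): on a good fibre `(k₁, k₃)` of the
cell the Lorentzian-regularised, `W`-weighted energy delta along the partner momentum `k₂`
converges as `ν ↓ 0` to `(π / alsPrefactor) Σᶠ_{k₂ ∈ resonantSet} collisionWeight · [f]²`, ALS's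
resolved collision kernel. [cite: AokiLukkarinenSpohn2006, eqs. (4.10)-(4.11)] -/
theorem tendsto_fibre_lorentzian_resonantSet : ∀ (ω₂ a b : ℝ), 0 < ω₂ → ∀ (f : ℝ → ℝ), Continuous f → ∀ (k₁ k₃ : ℝ), k₁ ∈ Set.Ioc (-Real.pi) Real.pi → k₃ ∈ Set.Ioc (-Real.pi) Real.pi → k₁ ≠ k₃ → resonanceFn ω₂ k₁ Real.pi k₃ ≠ 0 → (∀ k₂ : ℝ, resonanceFn ω₂ k₁ k₂ k₃ = 0 → groupVelocity ω₂ k₂ ≠ groupVelocity ω₂ (k₁ + k₂ - k₃)) → Filter.Tendsto (fun ν : ℝ => ∫ k₂ in Set.Ioc (-Real.pi) Real.pi, vertex a b k₁ k₂ k₃ ^ 2 / (dispersion ω₂ k₁ * dispersion ω₂ k₂ * dispersion ω₂ k₃ * dispersion ω₂ (k₁ + k₂ - k₃)) ^ 2 * (f k₁ + f k₂ - f k₃ - f (k₁ + k₂ - k₃)) ^ 2 * (ν / (resonanceFn ω₂ k₁ k₂ k₃ ^ 2 + ν ^ 2))) (nhdsWithin 0 (Set.Ioi 0)) (nhds (Real.pi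 / alsPrefactor * ∑ᶠ k₂ ∈ resonantSet ω₂ k₁ k₃, collisionWeight ω₂ a b k₁ k₂ k₃ * (f k₁ + f k₂ - f k₃ - f (k₁ + k₂ - k₃)) ^ 2)) :=
  fun _ _ _ hω _ hf _ _ hk₁ hk₃ hne hπ hsimple =>
    tendsto_fibre_lorentzian_resonantSet' hω hf hk₁ hk₃ hne hπ hsimple

/-! ## Almost every fibre is good -/

/-- **Degenerate zeros live on the equal-velocity curve.** On an off-diagonal fibre `(k₁, k₃)` of
the cell, a zero `k₂` of `Ω(k₁, ·, k₃)` with `v(k₂) = v(k₁ + k₂ - k₃)` is congruent to the exchange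
zero `k₃` (`Branch.modEq_of_velocity_eq`, the fibre being off the lattice diagonal by
`Closing.forall_sub_ne_of_mem_cell`), whence `v(k₃) = v(k₂) = v(k₁ + k₂ - k₃) = v(k₁)`.
[folklore] -/
theorem goodFibre_velocity_eq_of_degenerate {ω₂ : ℝ} (hω : 0 < ω₂) {k₁ k₃ : ℝ}
    (hk₁ : k₁ ∈ Ioc (-π) π) (hk₃ : k₃ ∈ Ioc (-π) π) (hne : k₁ ≠ k₃) {k₂ : ℝ}
    (hk₂ : resonanceFn ω₂ k₁ k₂ k₃ = 0)
    (hv : groupVelocity ω₂ k₂ = groupVelocity ω₂ (k₁ + k₂ - k₃)) :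
    groupVelocity ω₂ k₃ = groupVelocity ω₂ k₁ := by
  obtain ⟨n, hn⟩ := modEq_of_velocity_eq hω (Closing.forall_sub_ne_of_mem_cell hk₁ hk₃ hne) hk₂
    (resonanceFn_self ω₂ k₁ k₃) hv
  have e3 : k₃ = k₂ + n * (2 * π) := by linarith
  have e1 : k₁ + k₂ - k₃ = k₁ + (-n : ℤ) * (2 * π) := by push_cast; linarith
  rw [e3, Generic.groupVelocity_add_int_mul_two_pi, hv, e1, Generic.groupVelocity_add_int_mul_two_pi]

/-- `k₃ ↦ Ω(k₁, π, k₃)` is real-analytic (`ω₂ > 0`). [folklore] -/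
theorem goodFibre_analyticAt_resonanceFn₃ {ω₂ : ℝ} (hω : 0 < ω₂) (k₁ c x : ℝ) :
    AnalyticAt ℝ (fun s => resonanceFn ω₂ k₁ c s) x := by
  unfold resonanceFn
  have h3 := analyticAt_dispersion hω x
  have h4 : AnalyticAt ℝ (fun s : ℝ => dispersion ω₂ (k₁ + c - s)) x :=
    (analyticAt_dispersion hω (k₁ + c - x)).comp_of_eq (analyticAt_const.sub analyticAt_id) rfl
  exact (analyticAt_const.sub h3).sub h4

/-- For every `k₁`, the set `{k₃ | Ω(k₁, π, k₃) = 0}` is countable: `Ω(k₁, π, ·)` is real-analytic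
and vanishes on no interval (`Generic.resonanceFn_const_partner`), so its zeros are finite on every
`[m, m+1]`. [folklore] -/
theorem goodFibre_countable_resonant_pi {ω₂ : ℝ} (hω : 0 < ω₂) (k₁ : ℝ) :
    {k₃ : ℝ | resonanceFn ω₂ k₁ π k₃ = 0}.Countable := by
  have han := goodFibre_analyticAt_resonanceFn₃ hω k₁ π
  obtain ⟨x₀, hx₀⟩ : ∃ x₀, resonanceFn ω₂ k₁ π x₀ ≠ 0 := by
    by_contra h
    push Not at h
    exact Generic.resonanceFn_const_partner hω k₁ π zero_lt_one fun s _ => h s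
  have hcov : {k₃ : ℝ | resonanceFn ω₂ k₁ π k₃ = 0} ⊆
      ⋃ m : ℤ, {x | x ∈ Icc (m : ℝ) (m + 1) ∧ resonanceFn ω₂ k₁ π x = 0} := by
    intro x hx
    exact mem_iUnion.2 ⟨⌊x⌋, ⟨Int.floor_le x, (Int.lt_floor_add_one x).le⟩, hx⟩
  refine Set.Countable.mono hcov (Set.countable_iUnion fun m => ?_)
  exact (finite_zeros_of_analyticAt han hx₀ isCompact_Icc).countable

/-- The set `{(k₁, k₃) | Ω(k₁, π, k₃) = 0}` of fibres on which `π` is resonant is Lebesgue-null in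
`ℝ²` (closed, with countable `k₁`-sections; Tonelli). [folklore] -/
theorem goodFibre_volume_resonant_pi {ω₂ : ℝ} (hω : 0 < ω₂) :
    volume {p : ℝ × ℝ | resonanceFn ω₂ p.1 π p.2 = 0} = 0 := by
  have hc : Continuous fun p : ℝ × ℝ => resonanceFn ω₂ p.1 π p.2 := by
    unfold resonanceFn dispersion; fun_prop
  refine Generic.volume_prod_null_of_fibre (measurableSet_eq_fun hc.measurable measurable_const)
    fun x => ?_
  exact (goodFibre_countable_resonant_pi hω x).measure_zero volume

/-- **Almost every fibre is good** (binder form): for `volume`-a.e. `(k₁, k₃)` in the cell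
`(-π, π]²`, `k₁ ≠ k₃`, `π` is not a resonant partner momentum, and every zero of `Ω(k₁, ·, k₃)` is
simple (`v(k₂) ≠ v(k₁ + k₂ - k₃)`). [folklore] -/
theorem ae_goodFibre' {ω₂ : ℝ} (hω : 0 < ω₂) :
    ∀ᵐ p : ℝ × ℝ ∂(volume.restrict (Ioc (-π) π ×ˢ Ioc (-π) π)),
      p.1 ≠ p.2 ∧ resonanceFn ω₂ p.1 π p.2 ≠ 0 ∧
        ∀ k₂ : ℝ, resonanceFn ω₂ p.1 k₂ p.2 = 0 →
          groupVelocity ω₂ k₂ ≠ groupVelocity ω₂ (p.1 + k₂ - p.2) := by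
  have hcell : MeasurableSet (Ioc (-π) π ×ˢ Ioc (-π) π : Set (ℝ × ℝ)) :=
    measurableSet_Ioc.prod measurableSet_Ioc
  rw [ae_restrict_iff' hcell]
  have h2 := measure_eq_zero_iff_ae_notMem.1 (goodFibre_volume_resonant_pi hω)
  have h3 := measure_eq_zero_iff_ae_notMem.1 (Generic.volume_equalVelocity hω)
  filter_upwards [h2, h3] with p hp2 hp3 hp
  rw [mem_prod] at hp
  -- the diagonal lies on the equal-velocity curve
  have hp1 : p.1 ≠ p.2 := fun h => hp3 (by rw [h])
  exact ⟨hp1, hp2, fun k₂ hk₂ hv => hp3 (goodFibre_velocity_eq_of_degenerate hω hp.1 hp.2 hp1 hk₂ hv)⟩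

/-- **Almost every fibre is good** (registered helper stub of stub B): for a.e. `(k₁, k₃)` in the
cell `(-π, π]²` the hypotheses of the fibre dictionary hold — `k₁ ≠ k₃`, `Ω(k₁, π, k₃) ≠ 0`, and all
zeros of `Ω(k₁, ·, k₃)` are simple. [folklore] -/
theorem ae_goodFibre : ∀ (ω₂ : ℝ), 0 < ω₂ → ∀ᵐ p : ℝ × ℝ ∂(MeasureTheory.volume.restrict (Set.Ioc (-Real.pi) Real.pi ×ˢ Set.Ioc (-Real.pi) Real.pi)), p.1 ≠ p.2 ∧ resonanceFn ω₂ p.1 Real.pi p.2 ≠ 0 ∧ ∀ k₂ : ℝ, resonanceFn ω₂ p.1 k₂ p.2 = 0 → groupVelocity ω₂ k₂ ≠ groupVelocity ω₂ (p.1 + k₂ - p.2) :=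
  fun _ hω => ae_goodFibre' hω

end Summit.AtomisticToContinuum.FouriersLaw.Theorems.MourreDissolution

end
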